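import Summits.QuantumFields.YangMills.Theorems.BalabanUVNodesN12Prop1AssembledOfGaugeLetterAtToleranceLocOfChartLetterN
import Summits.QuantumFields.YangMills.Theorems.BalabanUVNodesN12GaugeLetterSocketAtRecordLocal

/-!
# (LOCAL EDITION — LOCATED-WJ repair: the datum letter `hWj` is asked only within walk-distance `ℓ_k + m′·L^k` of `Ω₁(Z_i)` (dag-n12-w3's LOCAL capstone p656396 via this seat's
# LOCAL socket `N12GaugeLetterSocketAtRecordLocal`); everything else VERBATIM dag-n12-w5 g5's (vii) `N12Prop1AssembledOfGaugeLetterLocAtRecordOfChartLetterN` p647987; typed by dag-n12-d g19 on the lane owner's word O2.)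
# BalabanUVNodes ∕ N12 — PROPOSITION 1 [IV] AT PRINT'S (1.74) OBJECT, THE FULL ASSEMBLY WITH THE GAUGE LETTER DISCHARGED BY dag-n12-w3's FOREST-FREE CAPSTONE («(vii)»): from the R-explicit
# (J0′) letter at a reference guard, the (σ)_N capstone `exists_gaugeLetterLoc_atRecord` with its three displayed letters read linear in the guard, dag-n12-w4's chart letter by name, the
# [15] Theorem-1 letter and the instance geometry

Cell `pub-ymgap` (HUMAN RULINGS D-0062 ∕ D-0149 ∕ D-0154), WIDTH SEAT `pub-ymgap-dag-n12-w5` g5 (node N12 = [B15]; key K1⁹ `stmt-QuantumFields-27364`, `--kind proof --supports …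
--as helper`; count-neutral).  dag-n12-d g19's word (pub-ymgap INBOX 2026-08-28T14:39:05Z: «when n12-w5 keys a (vii) on it, 12Q¹⁵∕12X-W v8 follows»).  THEOREMS ONLY (0 `def`, 0 `instance`, 0
`sorry`); composition BY NAME of this seat's (v) `N12Prop1AssembledOfGaugeLetterAtToleranceLocOfChartLetterN.…_ofGaugeLetterNAtTolerance_ofChartLetterN_ofCoercive` (p639701) and
`N12GaugeLetterSocketAtRecordLocal.hσN_of_gaugeLetterLocAtRecord_linear_local` (over dag-n12-w3 g4's `N12GaugeLetterLocAtRecord.exists_gaugeLetterLoc_atRecord`, p645693).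

WHY.  (vi) (p643325) replaced (v)'s `hσN` by dag-n12-w6's forest-package producer, displaying the rooted tower forest, budgets and the root-transporter letter.  dag-n12-w3 g4's
capstone puts those INSIDE (forest by `exists_towerForest_rooted_Bj`, graded budgets, transporter by `rootTransporter_atRecord_graded_of_plaqSmall`).  THIS FILE is (v) with the swap
executed at the capstone: `hσN` is REPLACED per instance by the no-wrap numerics `hNcap` (at the caps `ℓ_k`, `m·L^k`), the `N i`-geometry (`hGN` (gN1) at the region box, `hN1`
(gN2)), the reference guard and moduli (`e₀ cP cθ cδ`), and THREE DISPLAYED LETTERS read linear ∕ guard-indexed: the graded root-free PLAQUETTE letter at the minimiser `hP` on `S i`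
with the level-form box letter `hSΩ` ((1.7) ∕ [15] Thm 1 — the K0 door's output), the plaquette letter `ha` on the ITERATED AVERAGES of the minimiser near the member segments with
budgets `a i e`, `θ i e` (numerics `hθ0 ha0 haN hθ`, cap `θ i e (k i) ≤ cθ i·e`), and the DATUM letter `hWj` at the members.  After it the K1 knit's N12 Prop-1 row asks no gauge
letter, no chart letter, no forest, no transporter.

HONEST FRAMING.  Composition by name; the three letters, (J0′), the [15] Theorem-1 letter and the geometry stay DISPLAYED (their guard-linearity is the shape asked of the K0 door ∕ the
datum normalisation — the CLASS edition of the capstone does not have it, see dag-n12-c g20 ∕ dag-n12-w3 g4, pub-ymgap INBOX 2026-08-28T15:50Z); per the lane owner's LOCATED-GEOM v3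
the bondwise road serves instances with simply-connected, normalisable `Ω₁(Z_i)`; nothing of Bałaban's is asserted; count-neutral; N12 NOT discharged; K1⁹ NOT closed; counts unmoved;
one finite 𝕋⁴ programme at fixed `ε = L^{-K}` — R4 closes only the conditional rung `BalabanLadder.UV`; no summit statement is proved here and NOT the Yang–Mills mass gap (Clay);
nothing continuum ∕ ℝ⁴ ∕ OS.

References: [Balaban1989LargeFieldI] CMP 122 (1989) 175–202, (1.74) p.192, Prop. 1 (1.77)–(1.78) p.194, (1.79) p.195; [Balaban1989LargeFieldII] CMP 122 (1989) 355–392, p.357,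
(1.7)–(1.9) p.358, (1.12)–(1.13) p.359; [Balaban1985Variational] CMP 102 (1985) 277–309, (3)–(4) p.278, Thm 1 (8) p.279, (16)–(18) p.280, Prop. 9 (190) p.309; [Balaban1985RegularSpaces]
CMP 98 (1985), (1.7) p.77, (1.19) p.79; [Balaban1988Convergent] CMP 119 (1988) 243–285, (2.2) p.255, (2.11)–(2.14) pp.256–257, (2.16) p.257.
-/

noncomputable section

open Set Finset Metric Filter
open scoped BigOperators Matrix RealInnerProductSpace Real InnerProductSpace Topology Matrix.Norms.L2Operator

namespace Summit.QuantumFields.YangMills.BalabanUVNodes.N12Prop1AssembledOfGaugeLetterLocAtRecordLocalOfChartLetterN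

open Literature.MathematicalPhysics.QuantumFieldTheory.Balaban1983to89
open T4Continuum B15DeterminingSets GaugeField B16Sect1Backgrounds B15Prop1Carrier B8Eq17ClassAkV1 BlockAveraging
open B15Prop1SliceTaylorCalculus
open B15Prop1ChartCalculusSU2 (E3)
open T4CubeChartGnomonic (SU2)
open B15Prop1ChartSU2 (su2Chart)
open B15Prop1SliceCoordinates (GaugeSlice ιA freeBonds)
open B15Prop1AnalyticExtClause (cplxVec anExt)
open T4AdjointCovarianceUnitary (lieSU)
open T4AxialGaugeSmallField (castSite boxPlaqs boxBonds)
open B6BondElimination (unitVec)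
open B6TreeGaugePoincare (curl)
open B16Eq18Proof (box mem_box)
open B15Extension193 (extend)
open B15ShellGauge193 (shellGauge)
open B14.Eq213MaximalDomains (side)
open B14.Eq213DetSet B14.Eq216Concrete B15Sect1Instances B15Eq177GaugeInvariance B15Eq177ValueInvariance B15Eq177ValueInvarianceCoDiv B16Sect1Wilson
open B14.Eq22Determines (blockIter IsBlockUnion)
open B5Eq118OneStroke (iterBlockOf)
open ExpMeanLog (deltaSU)
open Literature.MathematicalPhysics.QuantumFieldTheory.BalabanImbrieJaffe1984to88.BIJ85Eq453GaugeField
open Node00 (expChart msChart constrCard)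
open Summit.QuantumFields.YangMills.BalabanUVNodes.N12GaugeLetterSocketAtRecordLocal (hσN_of_gaugeLetterLocAtRecord_linear_local)

variable {F : T4Family}

/-- ★★★ **PROPOSITION 1 [IV] AT PRINT'S (1.74) OBJECT — THE FULL ASSEMBLY WITH THE GAUGE LETTER (σ)_N DISCHARGED BY dag-n12-w3's FOREST-FREE CAPSTONE.**  (v) (p639701) with its
binder `hσN` REPLACED by the per-instance inputs of `N12GaugeLetterSocketAtRecordLocal.hσN_of_gaugeLetterLocAtRecord_linear_local`: no-wrap numerics, the `N i`-geometry, the reference guard and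
moduli, and the three displayed letters (plaquette letter at the minimiser with the level-form box letter; iterated-average plaquette letter with budgets; datum letter).  Conclusion
VERBATIM (v)'s.  Proof: (v) with `hσN := fun i => hσN_of_gaugeLetterLocAtRecord_linear …`.
[cite: Balaban1989LargeFieldI, (1.74) p.192, Prop. 1 (1.77)–(1.78) p.194 (incl. «for ε > 0 sufficiently small» and the last clause), (1.79) p.195; Balaban1989LargeFieldII, p.357,
(1.7)–(1.9) p.358, (1.12)–(1.13) p.359; Balaban1985Variational, (3)–(4) p.278, Thm 1 (8) p.279, (16)–(18) p.280, Prop. 9 (190) p.309; Balaban1988Convergent, (2.2) p.255, (2.11)–(2.14) pp.256–257] -/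
theorem exists_domain_prop1Printed_lfVarOn_std_su2_box_intrinsic_analytic_atZSeqCoPRecord_ofThm1TorusClass_ofMinimiserFamily_ofGaugeLetterLocAtRecordLocalAtTolerance_ofChartLetterN_ofCoercive
    (ν : Node00.Stage7Numerics) (Kt : ℕ) (hd3 : 3 ≤ (F.P Kt).d) (h0 : 0 < (F.P Kt).d) {ι : Type} [Finite ι]
    (Z Λ : ι → Set (Site (F.P Kt) 0)) (k : ι → ℕ) (M : ι → ℝ) (hk0 : ∀ i, 0 < k i) (hk : ∀ i, k i ≤ (F.P Kt).m + (F.P Kt).K)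
    -- the REFERENCE guard per instance (the guard of the row is chosen below it, inside)
    (eR₀ : ι → ℝ) (heR₀ : ∀ i, 0 < eR₀ i)
    (T : ∀ i, Finset (PBond (F.P Kt) (k i)))
    (lo hi : ι → Fin (F.P Kt).d → ℤ) (n : ι → ℕ) (hn : ∀ i κ, hi i κ ≤ lo i κ + n i) (hN : ∀ i, n i + 2 < (F.P Kt).sitesPerDir (k i))
    (hbox : ∀ i, pts (k i) (Λ i) = (castSite '' Set.Icc (lo i) (hi i) : Set (Site (F.P Kt) (k i))))
    (hZ : ∀ i, (boxPlaqs (lo i - 1) (hi i + 1) : Set (Plaq (F.P Kt) (k i))) ⊆ plaqsInside (pts (k i) (Z i)))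
    (hTG0 : ∀ i, T i = (box (fun κ => (hi i κ - lo i κ + 1).toNat) (lo i)).image fun x =>
      (⟨castSite (x - unitVec ⟨0, h0⟩), ⟨0, h0⟩⟩ : PBond (F.P Kt) (k i)))
    (hN5 : ∀ i κ, ((hi i κ - lo i κ + 1).toNat : ℤ) + 5 < (F.P Kt).sitesPerDir (k i))
    (ext : ∀ i, GaugeField (F.P Kt) (k i) SU2 → GaugeField (F.P Kt) (k i) SU2)
    (hext : ∀ i Vk, ext i Vk = extend (pts (k i) (Λ i)) (shellGauge Vk (lo i) (hi i)) Vk)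
    (hlohi : ∀ i, lo i ≤ hi i)
    -- the REGION parallelepipeds of the normalisation (the datum tolerances `ρn i` are chosen inside, linear in the guard)
    (LO HI : ι → Fin (F.P Kt).d → ℤ) (hLO : ∀ i, LO i ≤ lo i - 1) (hHI : ∀ i, hi i + 1 ≤ HI i) (n' : ι → ℕ) (hn' : ∀ i κ, HI i κ ≤ LO i κ + n' i)
    (hn'N : ∀ i, n' i < (F.P Kt).sitesPerDir (k i)) (hR' : ∀ i, (boxPlaqs (LO i) (HI i) : Set (Plaq (F.P Kt) (k i))) ⊆ plaqsInside (pts (k i) (Z i)))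
    {bx : ℝ} (hbx : 0 < bx)
    (hbxM : ∀ i, 12 * ((F.P Kt).d : ℝ) * ((n i : ℝ) + 2) ^ 2 ≤ bx * (M i) ^ 2)
    {R 𝓐₀ : ι → ℝ} (hM : ∀ i, 1 ≤ (M i)) (hR : ∀ i, 0 < R i)
    -- (J0′), R-EXPLICIT, AT THE REFERENCE GUARD: per instance one radius and one bound for every base field of the strict guard `eR₀ i`
    (hMin : ∀ i Vk, PlaqSmallOn (plaqsInside (pts (k i) (Z i ∩ (Λ i)ᶜ))) (eR₀ i) Vk →
      ∃ Ũ : VecField (F.P Kt) (k i) (EuclideanSpace ℂ (Fin 3)) × VecField (F.P Kt) (k i) (EuclideanSpace ℂ (Fin 3)) →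
          PBond (F.P Kt) 0 → Matrix (Fin 2) (Fin 2) ℂ,
        (∀ b a c, DifferentiableOn ℂ (fun z => Ũ z b a c) (ball 0 (R i))) ∧
        (∀ z ∈ ball (0 : VecField (F.P Kt) (k i) (EuclideanSpace ℂ (Fin 3)) × VecField (F.P Kt) (k i) (EuclideanSpace ℂ (Fin 3))) (R i),
          ∀ b a c, ‖Ũ z b a c‖ ≤ 𝓐₀ i) ∧
        ∀ p B' : VecField (F.P Kt) (k i) E3, ‖p‖ < R i → ‖B'‖ < R i → ∃ U' : GaugeField (F.P Kt) 0 SU2,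
          (∀ b, Ũ (cplxVec p, cplxVec B') b = ((U' b : SU2) : Matrix (Fin 2) (Fin 2) ℂ)) ∧
            IsMinimizer (Node00.avOfRecord F 2 Kt) (Node00.regMSCoPOfRecord F 2 ν Kt (k i) (maxDomT ν.M₁ (Z i))) (Bj ν.M₁ (Z i) (k i))
              (avgFamily (Node00.avOfRecord F 2 Kt) (qsstarGIter0 (k i) (expMul su2Chart B' (ext i (expMul su2Chart p Vk))))) U')
    (h𝓐₀ : ∀ i, 0 ≤ 𝓐₀ i)
    -- LOCATED-CIN (R-a): per instance the bond neighbourhood on which the `inputs` near-flatness is delivered ∕ asked, with dag-n12-w4's ONE geometry letter on it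
    (N : ι → Set (PBond (F.P Kt) 0)) (hNpos : ∀ i, B14.Eq12InteriorLocality.inputsPos (Bj ν.M₁ (Z i) (k i) : DetSet (F.P Kt)) ⊆ N i)
    -- (σ)_N DISCHARGED BY NAME from dag-n12-w3 g4's forest-free ∕ hT-free capstone: per instance the no-wrap numerics, the `N i`-geometry, and the three DISPLAYED
    -- letters read linear ∕ guard-indexed (graded root-free plaquette letter at the minimiser, iterated-average plaquette budgets `a`∕`θ`, datum letter at the members)
    -- no wrapping, at the caps `ℓ_k`, `m·L^k`
    (hNcap : ∀ i, 2 * (∑ l ∈ Finset.range (k i + 1), ((F.P Kt).d * (((F.P Kt).L ^ l - 1) / 2) + 1)) + 1 +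
      (3 * ((F.P Kt).d * (((F.P Kt).L - 1) / 2)) + 5) * (F.P Kt).L ^ (k i) < (F.P Kt).sitesPerDir 0)
    -- geometry of the neighbourhood `N i` (dag-n12-w6's letters; (gN1) at the region box, (gN2))
    (hGN : ∀ i, ∀ b ∈ (N i), (b.src ∉ maxDomT ν.M₁ (Z i) 1 ∨ b.tgt ∉ maxDomT ν.M₁ (Z i) 1) → blockIter (k i) b.tgt ≠ blockIter (k i) b.src →
      (⟨blockIter (k i) b.src, b.dir⟩ : PBond (F.P Kt) (k i)) ∈ (boxBonds (LO i) (HI i) : Set (PBond (F.P Kt) (k i))))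
    (hN1 : ∀ i, ∀ p : Plaq (F.P Kt) 0, ((⟨p.src, p.μ⟩ : PBond (F.P Kt) 0) ∈ {b : PBond (F.P Kt) 0 | b.src ∈ maxDomT ν.M₁ (Z i) 1} ∨
        (⟨p.src.shift p.μ, p.ν⟩ : PBond (F.P Kt) 0) ∈ {b : PBond (F.P Kt) 0 | b.src ∈ maxDomT ν.M₁ (Z i) 1} ∨
        (⟨p.src.shift p.ν, p.μ⟩ : PBond (F.P Kt) 0) ∈ {b : PBond (F.P Kt) 0 | b.src ∈ maxDomT ν.M₁ (Z i) 1} ∨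
        (⟨p.src, p.ν⟩ : PBond (F.P Kt) 0) ∈ {b : PBond (F.P Kt) 0 | b.src ∈ maxDomT ν.M₁ (Z i) 1}) →
      (⟨p.src, p.μ⟩ : PBond (F.P Kt) 0) ∈ (N i) ∧ (⟨p.src.shift p.μ, p.ν⟩ : PBond (F.P Kt) 0) ∈ (N i) ∧
        (⟨p.src.shift p.ν, p.μ⟩ : PBond (F.P Kt) 0) ∈ (N i) ∧ (⟨p.src, p.ν⟩ : PBond (F.P Kt) 0) ∈ (N i))
    -- the reference guard and the LINEAR moduli of the three displayed letters
    (e₀ cP cθ cδ : ι → ℝ) (he₀ : ∀ i, 0 < e₀ i) (hcP : ∀ i, 0 ≤ cP i) (hcδ : ∀ i, 0 ≤ cδ i)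
    -- DISPLAYED, LINEAR IN THE GUARD: ONE graded root-free plaquette letter for the minimiser ((1.7) ∕ [15] Thm 1), boxes in LEVEL FORM inside `S`
    (S : ι → Set (Plaq (F.P Kt) 0))
    (hP : ∀ i, ∀ e : ℝ, 0 < e → e ≤ (e₀ i) → ∀ (Vk : GaugeField (F.P Kt) (k i) SU2), PlaqSmallOn (plaqsInside (pts (k i) ((Z i) ∩ (Λ i)ᶜ))) e Vk →
      (∀ b ∈ (boxBonds (LO i) (HI i) : Set (PBond (F.P Kt) (k i))), dist1 ((ext i) Vk b) ≤
        (((F.P Kt).d : ℝ) * (n' i) + 1) * ((((F.P Kt).d - 1 : ℕ) : ℝ) * (n' i) * ((12 * (F.P Kt).d * ((n i) + 2) ^ 2 + 1) * e) + 3 * (F.P Kt).d * ((n i) + 2) ^ 2 * e)) →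
      ∀ U₀ : GaugeField (F.P Kt) 0 SU2,
        IsMinimizer (Node00.avOfRecord F 2 Kt) (Node00.regMSCoPOfRecord F 2 ν Kt (k i) (maxDomT ν.M₁ (Z i))) (Bj ν.M₁ (Z i) (k i))
          (avgFamily (Node00.avOfRecord F 2 Kt) (qsstarGIter0 (k i) ((ext i) Vk))) U₀ →
        PlaqSmallOn (S i) ((cP i) * e) U₀)
    (hSΩ : ∀ i, ∀ b : PBond (F.P Kt) 0, b.src ∈ maxDomT ν.M₁ (Z i) 1 → b.tgt ∈ maxDomT ν.M₁ (Z i) 1 →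
      ∀ J J' : ℕ, iterBlockOf J b.src ∈ (Bj ν.M₁ (Z i) (k i) : DetSet (F.P Kt)) J → iterBlockOf J' b.tgt ∈ (Bj ν.M₁ (Z i) (k i) : DetSet (F.P Kt)) J' →
      (boxPlaqs
          (fun κ => ((b.src κ).val : ℤ) -
            (((2 * max (∑ i ∈ Finset.range (J + 1), ((F.P Kt).d * (((F.P Kt).L ^ i - 1) / 2) + 1))
                  (∑ i ∈ Finset.range (J' + 1), ((F.P Kt).d * (((F.P Kt).L ^ i - 1) / 2) + 1)) + 1 +
                (3 * ((F.P Kt).d * (((F.P Kt).L - 1) / 2)) + 5) * (F.P Kt).L ^ min (J + 1) (k i)) +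
              ∑ i ∈ Finset.range (J + 1), ((F.P Kt).d * (((F.P Kt).L ^ i - 1) / 2) + 1) : ℕ) : ℤ))
          (fun κ => ((b.src κ).val : ℤ) +
            (((2 * max (∑ i ∈ Finset.range (J + 1), ((F.P Kt).d * (((F.P Kt).L ^ i - 1) / 2) + 1))
                  (∑ i ∈ Finset.range (J' + 1), ((F.P Kt).d * (((F.P Kt).L ^ i - 1) / 2) + 1)) + 1 +
                (3 * ((F.P Kt).d * (((F.P Kt).L - 1) / 2)) + 5) * (F.P Kt).L ^ min (J + 1) (k i)) +
              ∑ i ∈ Finset.range (J + 1), ((F.P Kt).d * (((F.P Kt).L ^ i - 1) / 2) + 1) : ℕ) : ℤ) + 2) : Set (Plaq (F.P Kt) 0)) ⊆ (S i))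
    -- DISPLAYED, GUARD-INDEXED: the plaquette letter on the iterated averages of the minimiser near the member segments, with its budgets `a e`, `θ e` (per guard `e`) and a LINEAR cap on `θ e k`
    (a θ : ι → ℝ → ℕ → ℝ) (hθ0 : ∀ i e, 0 ≤ θ i e 0) (ha0 : ∀ i e j, 0 ≤ a i e j)
    (haN : ∀ i, ∀ e : ℝ, 0 < e → e ≤ e₀ i → ∀ j < k i, (((((F.P Kt).d + 2) * (F.P Kt).L : ℕ) : ℝ) ^ 2 / 4) * a i e j < deltaSU (Fin 2))
    (hθ : ∀ i e j, 6 * ((((((F.P Kt).d + 2) * (F.P Kt).L : ℕ) : ℝ) ^ 2 / 4) * a i e j) + (F.P Kt).L * θ i e j ≤ θ i e (j + 1))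
    (hθk : ∀ i, ∀ e : ℝ, 0 < e → e ≤ e₀ i → θ i e (k i) ≤ cθ i * e)
    (ha : ∀ i, ∀ e : ℝ, 0 < e → e ≤ (e₀ i) → ∀ (Vk : GaugeField (F.P Kt) (k i) SU2), PlaqSmallOn (plaqsInside (pts (k i) ((Z i) ∩ (Λ i)ᶜ))) e Vk →
      (∀ b ∈ (boxBonds (LO i) (HI i) : Set (PBond (F.P Kt) (k i))), dist1 ((ext i) Vk b) ≤
        (((F.P Kt).d : ℝ) * (n' i) + 1) * ((((F.P Kt).d - 1 : ℕ) : ℝ) * (n' i) * ((12 * (F.P Kt).d * ((n i) + 2) ^ 2 + 1) * e) + 3 * (F.P Kt).d * ((n i) + 2) ^ 2 * e)) →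
      ∀ U₀ : GaugeField (F.P Kt) 0 SU2,
        IsMinimizer (Node00.avOfRecord F 2 Kt) (Node00.regMSCoPOfRecord F 2 ν Kt (k i) (maxDomT ν.M₁ (Z i))) (Bj ν.M₁ (Z i) (k i))
          (avgFamily (Node00.avOfRecord F 2 Kt) (qsstarGIter0 (k i) ((ext i) Vk))) U₀ →
      ∀ lv ≤ (k i), ∀ c ∈ bondsOf ((Bj ν.M₁ (Z i) (k i) : DetSet (F.P Kt)) lv), ∀ j < lv, ∀ c' : PBond (F.P Kt) (j + 1), c'.dir = c.dir →
      (∃ s < (F.P Kt).L ^ lv, embIter (j + 1) c'.src = (fun z : Site (F.P Kt) 0 => z.shift c.dir)^[s] (embIter lv c.src)) →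
      ∀ q : Plaq (F.P Kt) j, (blockOf q.src = c'.src.unshift c'.dir ∨ blockOf q.src = c'.src ∨ blockOf q.src = c'.tgt) →
        dist1 (GaugeField.plaqHol (avgFamily (Node00.avOfRecord F 2 Kt) U₀ j) q) < a i e j)
    -- DISPLAYED, LINEAR IN THE GUARD: the datum letter at the members (levels `≤ k`) for every guarded base field
    (hWj : ∀ i, ∀ e : ℝ, 0 < e → e ≤ (e₀ i) → ∀ (Vk : GaugeField (F.P Kt) (k i) SU2), PlaqSmallOn (plaqsInside (pts (k i) ((Z i) ∩ (Λ i)ᶜ))) e Vk →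
      (∀ b ∈ (boxBonds (LO i) (HI i) : Set (PBond (F.P Kt) (k i))), dist1 ((ext i) Vk b) ≤
        (((F.P Kt).d : ℝ) * (n' i) + 1) * ((((F.P Kt).d - 1 : ℕ) : ℝ) * (n' i) * ((12 * (F.P Kt).d * ((n i) + 2) ^ 2 + 1) * e) + 3 * (F.P Kt).d * ((n i) + 2) ^ 2 * e)) →
      ∀ x ∈ maxDomT ν.M₁ (Z i) 1, ∀ lv ≤ (k i), ∀ c ∈ bondsOf ((Bj ν.M₁ (Z i) (k i) : DetSet (F.P Kt)) lv),
        (∃ w : List (Letter (F.P Kt).d), w.length ≤ (∑ l ∈ Finset.range ((k i) + 1), ((F.P Kt).d * (((F.P Kt).L ^ l - 1) / 2) + 1)) + (3 * ((F.P Kt).d * (((F.P Kt).L - 1) / 2)) + 5) * (F.P Kt).L ^ (k i) ∧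
          (walkEnd x w = embIter lv c.src ∨ walkEnd x w = embIter lv c.tgt)) →
        dist1 (avgFamily (Node00.avOfRecord F 2 Kt) (qsstarGIter0 (k i) ((ext i) Vk)) lv c) ≤ (cδ i) * e)
    -- dag-n12-w4's GEOMETRY letter of the chart file (its chart constants and the localised chart body are supplied INSIDE, from `chartLetter_of_letters_N`)
    (hΩw : ∀ i, ∀ (ν' : Fin (F.P Kt).d), ∀ z ∈ box (fun κ => (hi i κ - lo i κ + 1).toNat + 3) (fun κ => lo i κ - 2),
      (castSite z : Site (F.P Kt) (k i)) ∈ pts (k i) (maxDomT ν.M₁ (Z i) (k i)) ∧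
        (castSite z : Site (F.P Kt) (k i)).shift ⟨0, h0⟩ ∈ pts (k i) (maxDomT ν.M₁ (Z i) (k i)) ∧
        (castSite z : Site (F.P Kt) (k i)).shift ν' ∈ pts (k i) (maxDomT ν.M₁ (Z i) (k i)))
    (hfar : ∀ i (b : PBond (F.P Kt) 0), b.src ∉ maxDomT ν.M₁ (Z i) 1 →
      (⟨blockIter (k i) b.src, b.dir⟩ : PBond (F.P Kt) (k i)) ∉ bondsOf (pts (k i) (Λ i)))
    (hZblk : ∀ i, IsBlockUnion (k i) (Z i))
    (hM2 : 2 ≤ ν.M₁) (hdiv : ∀ i, side (F.P Kt).L ν.M₁ (k i) ∣ (F.P Kt).sitesPerDir 0)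
    {B₃ a₀ a₁' : ℝ} (hB₃ : 0 ≤ B₃) (ha₁' : 0 < a₁') (hεreg : 0 < ν.εreg) (ha₀ : ν.εreg ≤ a₀)
    (h15T : ∀ (k' : ℕ), k' ≤ (F.P Kt).m + (F.P Kt).K → side (F.P Kt).L ν.M₁ k' ∣ (F.P Kt).sitesPerDir 0 →
      ∀ (s : B14.Eq218Concrete.Seq (fun n : ℕ => Node00.unionsOfCubes (F.P Kt) (side (F.P Kt).L ν.M₁ n)) k'),
      Node00.Sect2.SeqSeparated ν.M₁ s → 0 < ν.M₁ →
      ∀ (ε₀ : ℝ) (δ : ℕ → ℝ), (∀ j, j ≤ k' → 0 < δ j ∧ δ j ≤ a₁' ∧ B₃ * δ j ≤ ε₀) → (∀ j, j < k' → δ j ≤ 2 * δ (j + 1)) →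
      (∀ j, j < k' → δ (j + 1) ≤ 2 * δ j) → ε₀ ≤ a₀ →
      ∀ W : MSField (F.P Kt) SU2,
        Node00.Sect2.DataSmall7PTop (Node00.avOfRecord F 2 Kt) s.Ω (Node00.suppDomOfRecord F ν Kt s.Ω) k' δ W →
        ∀ U₀ : GaugeField (F.P Kt) 0 SU2, IsMinimizer (Node00.avOfRecord F 2 Kt)
            {U | (∀ j, j ≤ k' → PlaqSmallOn (Node00.Sect2.omegaPlaqsTop s.Ω (Node00.suppDomOfRecord F ν Kt s.Ω) j)
                (ε₀ * (F.P Kt).eta j ^ 2) U) ∧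
              Node00.Sect2.CoDivClassOnTop s.Ω (Node00.suppDomOfRecord F ν Kt s.Ω) k' ε₀ U}
            (genSet s.Ω k') W U₀ →
          (∀ j, j ≤ k' → PlaqSmallOn (Node00.Sect2.omegaPlaqsTop s.Ω (Node00.suppDomOfRecord F ν Kt s.Ω) j)
              (B₃ * δ j * (F.P Kt).eta j ^ 2) U₀) ∧
            ∀ j, j ≤ k' → Node00.Sect2.CoDivSmallOn (Node00.Sect2.omegaBondsTop s.Ω (Node00.suppDomOfRecord F ν Kt s.Ω) j)
              (B₃ * δ j * (F.P Kt).eta j ^ 3) U₀)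
    : ∃ a₁ : ι → ℝ, (∀ i, 0 < a₁ i) ∧
      B15.Prop1Printed (lfVarOn su2Chart fun i =>
        InstOn.std (Node00.bgMSCoPOfRecord F 2 ν Kt (k i) (maxDomT ν.M₁ (Z i))) ν.M₁ (Z i) (Λ i) (k i) (M i) (a₁ i)
          (anExt (pts (k i) (Λ i)) (T i)
            (fun177std (Node00.bgMSCoPOfRecord F 2 ν Kt (k i) (maxDomT ν.M₁ (Z i))) ν.M₁ (Z i) (k i)) (ext i)
            (min (1 / 2) (min (R i / 8) ((12 * ((F.P Kt).d : ℝ)) ^ 2 / (10 * bx ^ 2) / (M i) ^ 5 * (R i / 2) ^ 2 /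
              (48 * (4 * ((Fintype.card (Plaq (F.P Kt) 0) : ℝ) * (1 + 8 * 𝓐₀ i ^ 4)) / R i + 1)))))))
    := by
  refine N12Prop1AssembledOfGaugeLetterAtToleranceLocOfChartLetterN.exists_domain_prop1Printed_lfVarOn_std_su2_box_intrinsic_analytic_atZSeqCoPRecord_ofThm1TorusClass_ofMinimiserFamily_ofGaugeLetterNAtTolerance_ofChartLetterN_ofCoercive
    ν Kt hd3 h0 Z Λ k M hk0 hk eR₀ heR₀ T lo hi n hn hN hbox hZ hTG0 hN5 ext hext hlohi LO HI hLO hHI n' hn' hn'N hR' hbx hbxM hM hR hMin h𝓐₀ N hNpos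
    (fun i => ?_) hΩw hfar hZblk hM2 hdiv hB₃ ha₁' hεreg ha₀ h15T
  exact hσN_of_gaugeLetterLocAtRecord_linear_local ν Kt (hk0 i) (hk i) hM2 (hdiv i) (Z i) (hNcap i) (Λ i) (ext i) (LO i) (HI i) (n i) (n' i) (N i) (hGN i) (hN1 i)
    (he₀ i) (hcP i) (hcδ i) (hP i) (hSΩ i) (a i) (θ i) (hθ0 i) (ha0 i) (haN i) (hθ i) (hθk i) (ha i) (hWj i)

end Summit.QuantumFields.YangMills.BalabanUVNodes.N12Prop1AssembledOfGaugeLetterLocAtRecordLocalOfChartLetterN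

end
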